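import Mathlib.Topology.Algebra.ClopenNhdofOne
import Literature.AnabelianGeometry.SemiGraphs.PSCCoveringMapAlong
import Literature.AnabelianGeometry.Anabelioids.ProSigmaProofs
import HarnessLib

/-!
# Presentations of the maximal pro-`S` quotient: the kernel, its invariance, existence (proofs)

PROOF-ONLY companion of `PSCCoveringMapAlong.lean` ([CombGC] Thm. 1.6 (i), author's ms p. 13:
"we may assume that `Σ = {l}`" — passage to the maximal pro-`l` quotient `Π_G ↠ Π_G^{(l)}`
[cite: MochizukiCombGC2007, Thm 1.6(i) p.13]).  For the predicate
`PSCDatum.IsMaxProSigmaQuotient S f` ("`f : Π ↠ Q` presents the maximal pro-`S` quotient"):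

* `IsMaxProSigmaQuotient.ker_eq_iInf` — for profinite `Q` the kernel IS
  `K_S(Π) = ⋂ {N ⊴ Π open, [Π : N] an S-integer}` (hence independent of the presentation);
* `IsMaxProSigmaQuotient.map_ker_eq` — an isomorphism `α : Π ≅ Π'` carries the kernel of any
  presentation for `Π` onto the kernel of any presentation for `Π'` (`K_S` is "topologically
  characteristic"): the input of `exists_over_of_ker_map_eq` (`PSCCompactificationTransfer.lean`)
  producing the induced `ᾱ^{(l)} : Π^{(l)} ≅ Π'^{(l)}` over `α`;
* `exists_isMaxProSigmaQuotient` — for profinite `Π` and any `S`, the canonical quotient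
  `Π ↠ Π ⧸ K_S(Π)` IS such a presentation (existence, as a theorem: the quotient is pro-`S` by the
  finite-subfamily compactness argument).

Plain profinite group theory; no definitions; no statement takes a side on [IUTchIII] Cor. 3.12.
-/

namespace Literature.AnabelianGeometry.SemiGraphs

namespace PSCDatum

open Anabelioids

universe u

variable {P : Type u} [Group P] [TopologicalSpace P]
variable {Q : Type u} [Group Q] [TopologicalSpace Q]

omit [TopologicalSpace P] in
/-- `⊤` has `S`-integer index `1`. [cite: MochizukiCombGC2007, Thm 1.6(i) p.13] -/
private theorem isSigmaInteger_index_top (S : Set ℕ) : IsSigmaInteger S (⊤ : Subgroup P).index := by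
  rw [Subgroup.index_top]; exact IsSigmaInteger.one S

/-! ### The kernel of a presentation is `K_S(Π)` -/

/-- **The kernel of a presentation of the maximal pro-`S` quotient is
`⋂ {N ⊴ Π open of S-integer index}`** (`Q` profinite: its open normal subgroups separate points
and have `S`-integer index). [cite: MochizukiCombGC2007, Thm 1.6(i) p.13] -/
theorem IsMaxProSigmaQuotient.ker_eq_iInf [IsTopologicalGroup Q] [CompactSpace Q]
    [TotallyDisconnectedSpace Q] {S : Set ℕ} {f : P →* Q} (h : IsMaxProSigmaQuotient S f) :
    f.ker = ⨅ N : {N : Subgroup P // N.Normal ∧ IsOpen (N : Set P) ∧ IsSigmaInteger S N.index},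
      (N : Subgroup P) := by
  apply le_antisymm
  · exact le_iInf fun N => h.ker_le N.1 N.2.1 N.2.2.1 N.2.2.2
  · intro x hx
    rw [MonoidHom.mem_ker]
    by_contra hne
    -- an open normal subgroup of `Q` missing `f x`
    obtain ⟨M, hM⟩ := ProfiniteGrp.exist_openNormalSubgroup_sub_open_nhds_of_one
      (isOpen_compl_singleton (x := f x)) (by simpa using (Ne.symm hne))
    have hfx : f x ∉ (M : Set Q) := fun hm => hM hm rfl
    -- its preimage is in the family
    haveI : M.toSubgroup.Normal := M.isNormal'
    haveI : Finite (Q ⧸ M.toSubgroup) := Subgroup.quotient_finite_of_isOpen _ M.isOpen'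
    haveI : M.toSubgroup.FiniteIndex := Subgroup.finiteIndex_of_finite_quotient
    have hidx : IsSigmaInteger S (M.toSubgroup.comap f).index := by
      rw [Subgroup.index_comap_of_surjective M.toSubgroup h.surjective]
      exact ⟨Nat.pos_of_ne_zero Subgroup.FiniteIndex.index_ne_zero,
        fun p hp hdvd => h.proSigma.prime_mem M inferInstance p hp hdvd⟩
    have hN : (M.toSubgroup.comap f).Normal ∧ IsOpen ((M.toSubgroup.comap f : Subgroup P) : Set P) ∧
        IsSigmaInteger S (M.toSubgroup.comap f).index :=
      ⟨inferInstance, M.isOpen'.preimage h.continuous, hidx⟩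
    have hxN := (Subgroup.mem_iInf.mp hx) ⟨_, hN⟩
    exact hfx hxN

/-- **`K_S` is topologically characteristic**: an isomorphism of topological groups `α : Π ≅ Π'`
carries the kernel of any presentation of the maximal pro-`S` quotient of `Π` onto that of any
presentation for `Π'` (profinite targets). [cite: MochizukiCombGC2007, Thm 1.6(i) p.13] -/
theorem IsMaxProSigmaQuotient.map_ker_eq [IsTopologicalGroup Q] [CompactSpace Q]
    [TotallyDisconnectedSpace Q] {P' : Type u} [Group P'] [TopologicalSpace P']
    {Q' : Type u} [Group Q'] [TopologicalSpace Q'] [IsTopologicalGroup Q'] [CompactSpace Q']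
    [TotallyDisconnectedSpace Q'] {S : Set ℕ} {f : P →* Q} {f' : P' →* Q'}
    (h : IsMaxProSigmaQuotient S f) (h' : IsMaxProSigmaQuotient S f') (α : P ≃ₜ* P') :
    f.ker.map α.toMulEquiv.toMonoidHom = f'.ker := by
  -- the two index families correspond under `α`
  have fam : ∀ {R R' : Type u} [Group R] [TopologicalSpace R] [Group R'] [TopologicalSpace R']
      (e : R ≃ₜ* R') (N : Subgroup R), N.Normal → IsOpen (N : Set R) → IsSigmaInteger S N.index →
      (N.map e.toMulEquiv.toMonoidHom).Normal ∧
        IsOpen ((N.map e.toMulEquiv.toMonoidHom : Subgroup R') : Set R') ∧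
        IsSigmaInteger S (N.map e.toMulEquiv.toMonoidHom).index := by
    intro R R' _ _ _ _ e N hn ho hi
    refine ⟨Subgroup.Normal.map hn _ e.surjective, ?_, ?_⟩
    · have : ((N.map e.toMulEquiv.toMonoidHom : Subgroup R') : Set R') = e '' (N : Set R) := rfl
      rw [this]
      exact e.toHomeomorph.isOpenMap _ ho
    · rwa [Subgroup.index_map_of_bijective (f := e.toMulEquiv.toMonoidHom) e.bijective]
  rw [h.ker_eq_iInf, h'.ker_eq_iInf]
  have htop : (⊤ : Subgroup P).Normal ∧ IsOpen ((⊤ : Subgroup P) : Set P) ∧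
      IsSigmaInteger S (⊤ : Subgroup P).index :=
    ⟨inferInstance, isOpen_univ, isSigmaInteger_index_top S⟩
  haveI : Nonempty {N : Subgroup P // N.Normal ∧ IsOpen (N : Set P) ∧ IsSigmaInteger S N.index} :=
    ⟨⟨⊤, htop⟩⟩
  rw [Subgroup.map_iInf _ α.injective]
  apply le_antisymm
  · refine le_iInf fun N' => ?_
    obtain ⟨hn, ho, hi⟩ := fam α.symm N'.1 N'.2.1 N'.2.2.1 N'.2.2.2
    refine (iInf_le _ ⟨_, hn, ho, hi⟩).trans (le_of_eq ?_)
    rw [Subgroup.map_map]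
    convert Subgroup.map_id N'.1
    ext x
    exact α.apply_symm_apply x
  · refine le_iInf fun N => ?_
    obtain ⟨hn, ho, hi⟩ := fam α N.1 N.2.1 N.2.2.1 N.2.2.2
    exact iInf_le (fun N' : {N : Subgroup P' // N.Normal ∧ IsOpen (N : Set P') ∧
      IsSigmaInteger S N.index} => (N' : Subgroup P')) ⟨_, hn, ho, hi⟩

/-! ### Existence: `Π ↠ Π ⧸ K_S(Π)` presents the maximal pro-`S` quotient -/

omit [TopologicalSpace P] in
/-- A finite intersection of normal `S`-index subgroups has `S`-integer index.
[cite: MochizukiCombGC2007, Thm 1.6(i) p.13] -/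
private theorem isSigmaInteger_index_finset_inf {S : Set ℕ} {ι : Type*} (N : ι → Subgroup P)
    (hn : ∀ i, (N i).Normal) (hi : ∀ i, IsSigmaInteger S (N i).index) (t : Finset ι) :
    IsSigmaInteger S (t.inf N).index := by
  classical
  induction t using Finset.induction_on with
  | empty => rw [Finset.inf_empty, Subgroup.index_top]; exact IsSigmaInteger.one S
  | insert a t ha ih =>
    rw [Finset.inf_insert]
    haveI := hn a
    exact IsSigmaInteger.index_inf (hi a) ih

/-- **Existence of a presentation of the maximal pro-`S` quotient** of a profinite group `Π`:
`K := ⋂ {N ⊴ Π open of S-integer index}` is a closed normal subgroup and `Π ↠ Π ⧸ K` is such a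
presentation — `Π ⧸ K` is pro-`S` because an open normal subgroup containing `K` already contains a
FINITE intersection of members of the family (compactness), whose index is an `S`-integer.
[cite: MochizukiCombGC2007, Thm 1.6(i) p.13] -/
theorem exists_isMaxProSigmaQuotient (S : Set ℕ) [IsTopologicalGroup P] [CompactSpace P]
    [TotallyDisconnectedSpace P] :
    ∃ (K : Subgroup P) (_ : K.Normal), IsClosed (K : Set P) ∧
      IsMaxProSigmaQuotient S (QuotientGroup.mk' K) := by
  let K : Subgroup P := ⨅ N : {N : Subgroup P // N.Normal ∧ IsOpen (N : Set P) ∧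
    IsSigmaInteger S N.index}, (N : Subgroup P)
  haveI hKn : K.Normal := Subgroup.normal_iInf_normal fun N => N.2.1
  have hKc : IsClosed (K : Set P) := by
    rw [Subgroup.coe_iInf]
    exact isClosed_iInter fun N => Subgroup.isClosed_of_isOpen _ N.2.2.1
  refine ⟨K, hKn, hKc, ⟨QuotientGroup.continuous_mk, QuotientGroup.mk'_surjective K, ?_, ?_⟩⟩
  · -- `Π ⧸ K` is pro-`S`
    refine ⟨fun M hfin p hp hdvd => ?_⟩
    let N' : Subgroup P := M.toSubgroup.comap (QuotientGroup.mk' K)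
    have hN'o : IsOpen (N' : Set P) := M.isOpen'.preimage QuotientGroup.continuous_mk
    have hKN' : K ≤ N' := by
      have hk := MonoidHom.ker_le_comap (QuotientGroup.mk' K) M.toSubgroup
      rwa [QuotientGroup.ker_mk'] at hk
    -- compactness: finitely many members of the family already lie in `N'`
    obtain ⟨t, ht⟩ := (hN'o.isClosed_compl).isCompact.elim_finite_subfamily_closed
      (fun N : {N : Subgroup P // N.Normal ∧ IsOpen (N : Set P) ∧ IsSigmaInteger S N.index} =>
        ((N : Subgroup P) : Set P))
      (fun N => Subgroup.isClosed_of_isOpen _ N.2.2.1)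
      (by
        rw [← Subgroup.coe_iInf, ← Set.disjoint_iff_inter_eq_empty, disjoint_compl_left_iff]
        exact hKN')
    have hle : (t.inf fun N => (N : Subgroup P)) ≤ N' := by
      intro x hx
      by_contra hxN
      have : x ∈ (N' : Set P)ᶜ ∩ ⋂ N ∈ t, ((N : Subgroup P) : Set P) := by
        refine ⟨hxN, Set.mem_iInter₂.mpr fun N hN => ?_⟩
        exact (Finset.inf_le hN : (t.inf fun N => (N : Subgroup P)) ≤ N) hx
      rw [ht] at this
      exact this
    have hS : IsSigmaInteger S (t.inf fun N => (N : Subgroup P)).index :=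
      isSigmaInteger_index_finset_inf _ (fun N => N.2.1) (fun N => N.2.2.2) t
    have hN'S : IsSigmaInteger S N'.index := hS.of_dvd (Subgroup.index_dvd_of_le hle)
    have hidx : Nat.card ((P ⧸ K) ⧸ M.toSubgroup) = N'.index :=
      (Subgroup.index_comap_of_surjective M.toSubgroup (QuotientGroup.mk'_surjective K)).symm
    rw [hidx] at hdvd
    exact hN'S.2 p hp hdvd
  · intro N hn ho hi
    rw [QuotientGroup.ker_mk']
    exact iInf_le (fun N : {N : Subgroup P // N.Normal ∧ IsOpen (N : Set P) ∧
      IsSigmaInteger S N.index} => (N : Subgroup P)) ⟨N, hn, ho, hi⟩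

end PSCDatum

end Literature.AnabelianGeometry.SemiGraphs
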